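import Mathlib
import Summits.Ventures.PercRepro.TriangleCapStarFamilyTwoWitness

/-!
# PercRepro — TWO BELOW THE THRESHOLD IN THE LOWER REGIME `2 r ≤ D`: THE TWO-SHORT STAR FAMILY WITH `r − 2` INSIDE
EDGES BEATS THE BIPARTITE VALUE FOR `r ≥ 4` (p3, gen 57; part 345)

`3 ≤ r`, `2 r ≤ D`, `m = D + r − 3` (two below the threshold `m ≥ D + r − 1` of part 319), `t = m D + r`: the
two-short star family of part 343 with `a = r − 2` specials, `Rc = r` centre rows, both short rows of size `1`
(`sh0 = sh1 = D − 1`), `Q = D − 1` regular columns and no extra row is a graph of the band with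
`2 j + 2 t (D − 1) = t (t − 1) + 2 (r − 2) + (2 r − 2)(D − 2 r + 2) + 2 (D − 1)` — the abstract value `g(r − 2) + 2`
of `I = r − 2` inside edges (the centre a partial column of degree `2 r − 2`, `m + 2` active rows)
(`zone_two_below_witness`).  It is below the bipartite value `t (t − 1) + 2 r (D − r)` by `2 (r − 2)(r − 3) − 2`, i.e.
for every `r ≥ 4` (`zone_two_below_lt_bipartite`; `(D, r, m) = (8, 4, 9)`: `30 < 32`, `(10, 5, 12)`: `40 < 50`),
so the census reading "the bipartite value below the threshold" fails two below as well (the g56 zone theorem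
`zone_one_below_exact_all` refuted it one below).  Axioms: standard.
-/

namespace PercRepro

namespace TriangleCap

namespace C047

open Finset

/-- The value of the two-short star family with `a = r − 2`, `Rc = r`, `sh0 = sh1 = D − 1`:
`2 (r − 2) + (2 r − 2)(D − 2 r + 2) + 2 (D − 1)`. -/
theorem two_below_value_arith (D r : ℕ) (hr : 3 ≤ r) (h2 : 2 * r ≤ D) :
    2 * (r - 2) + ((r + (r - 2)) * (D - (r + (r - 2))) + ((D - (D - 1)) * (D - 1) + (D - (D - 1)) * (D - 1))) =
      2 * (r - 2) + (2 * r - 2) * (D - 2 * r + 2) + 2 * (D - 1) := by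
  obtain ⟨r', rfl⟩ : ∃ r', r = r' + 3 := ⟨r - 3, by omega⟩
  obtain ⟨u, rfl⟩ : ∃ u, D = 2 * (r' + 3) + u := ⟨D - 2 * (r' + 3), by omega⟩
  have e1 : r' + 3 - 2 = r' + 1 := by omega
  have e2 : 2 * (r' + 3) + u - (r' + 3 + (r' + 1)) = u + 2 := by omega
  have e3 : 2 * (r' + 3) + u - (2 * (r' + 3) + u - 1) = 1 := by omega
  have e4 : 2 * (r' + 3) + u - 1 = 2 * r' + u + 5 := by omega
  have e5 : 2 * (r' + 3) - 2 = 2 * r' + 4 := by omega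
  have e6 : 2 * (r' + 3) + u - 2 * (r' + 3) + 2 = u + 2 := by omega
  rw [e1, e2, e3, e4, e5, e6]
  ring

/-- **TWO BELOW THE THRESHOLD, LOWER REGIME — THE WITNESS:** for `3 ≤ r`, `2 r ≤ D`, `m + 3 = D + r`,
`t = m D + r`, `m + 1 ≤ ℓ`, `2 t ≤ s`: a triangle-free graph on `ℓ + 1 + (s − t)` vertices with `s` edges, a vertex
`w` of degree `s − t`, every off-degree `≤ D`, a non-neighbour of off-degree exactly `D`, and the band value
`2 j + 2 t (D − 1) = t (t − 1) + 2 (r − 2) + (2 r − 2)(D − 2 r + 2) + 2 (D − 1)`. -/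
theorem zone_two_below_witness (s ℓ m r D : ℕ) (hr : 3 ≤ r) (h2 : 2 * r ≤ D) (hm : m + 3 = D + r)
    (hmℓ : m + 1 ≤ ℓ) (hs : 2 * (m * D + r) ≤ s) :
    ∃ (H : SimpleGraph (Fin (ℓ + 1 + (s - (m * D + r))))) (_ : DecidableRel H.Adj), H.CliqueFree 3 ∧
      H.edgeFinset.card = s ∧ ∃ w, deg H w + (m * D + r) = s ∧ (∀ v, offDeg H w v ≤ D) ∧
        (∃ x, ¬ H.Adj w x ∧ offDeg H w x = D) ∧
        ∃ j, ∑ v, deg H v * deg H v + 2 * ((m * D + r) * (s - (m * D + r) - 1)) + 2 * j = s * (s + 1) ∧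
          2 * j + 2 * ((m * D + r) * (D - 1)) =
            (m * D + r) * (m * D + r - 1) + (2 * (r - 2) + (2 * r - 2) * (D - 2 * r + 2) + 2 * (D - 1)) := by
  have ht : m * D + r = r + (r - 2) * (D - 1) + (D - 1) * D + (r - 2) := by
    obtain ⟨r', rfl⟩ : ∃ r', r = r' + 3 := ⟨r - 3, by omega⟩
    obtain ⟨D', rfl⟩ : ∃ D', D = D' + 1 := ⟨D - 1, by omega⟩
    have hm' : m = D' + r' + 1 := by omega
    subst hm'
    have e1 : r' + 3 - 2 = r' + 1 := by omega
    rw [e1, Nat.add_sub_cancel]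
    ring
  have hinc : r * (D - 1) + (D - 1) * (D - (r - 2)) + 0 * D = (D - 1) * D + (D - 1 + (D - 1)) := by
    obtain ⟨r', rfl⟩ : ∃ r', r = r' + 3 := ⟨r - 3, by omega⟩
    obtain ⟨D', rfl⟩ : ∃ D', D = D' + 1 := ⟨D - 1, by omega⟩
    have e1 : r' + 3 - 2 = r' + 1 := by omega
    have e2 : D' + 1 - (r' + 1) = D' - r' := by omega
    rw [e1, Nat.add_sub_cancel, e2]
    obtain ⟨u, hu⟩ : ∃ u, D' = r' + u := ⟨D' - r', by omega⟩
    subst hu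
    rw [Nat.add_sub_cancel_left]
    ring
  obtain ⟨H, inst, hfree, hcard, w, hw, hD', hx, j, hj, hval⟩ :=
    starFamilyTwoWitness s ℓ (m * D + r) D (r - 2) r (D - 1) (D - 1) 0 (D - 1) ht (by omega) (by omega) (by omega)
      (by omega) (by omega) (by omega) (by omega) (fun h => by omega) hinc (by omega) hs
  refine ⟨H, inst, hfree, hcard, w, hw, hD', hx, j, hj, ?_⟩
  have harith := two_below_value_arith D r hr h2
  omega

/-- **BELOW THE BIPARTITE VALUE FOR `r ≥ 4`:**
`2 (r − 2) + (2 r − 2)(D − 2 r + 2) + 2 (D − 1) + (2 (r − 2)(r − 3) − 2) = 2 r (D − r)`, and `2 (r − 2)(r − 3) ≥ 4`. -/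
theorem zone_two_below_lt_bipartite (D r : ℕ) (hr : 4 ≤ r) (h2 : 2 * r ≤ D) :
    2 * (r - 2) + (2 * r - 2) * (D - 2 * r + 2) + 2 * (D - 1) + 2 ≤ 2 * (r * (D - r)) := by
  obtain ⟨r', rfl⟩ : ∃ r', r = r' + 4 := ⟨r - 4, by omega⟩
  obtain ⟨u, rfl⟩ : ∃ u, D = 2 * (r' + 4) + u := ⟨D - 2 * (r' + 4), by omega⟩
  have e1 : r' + 4 - 2 = r' + 2 := by omega
  have e2 : 2 * (r' + 4) - 2 = 2 * r' + 6 := by omega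
  have e3 : 2 * (r' + 4) + u - 2 * (r' + 4) + 2 = u + 2 := by omega
  have e4 : 2 * (r' + 4) + u - 1 = 2 * r' + u + 7 := by omega
  have e5 : 2 * (r' + 4) + u - (r' + 4) = r' + 4 + u := by omega
  rw [e1, e2, e3, e4, e5]
  nlinarith [Nat.zero_le (r' * u), Nat.zero_le (r' * r')]

end C047

end TriangleCap

end PercRepro
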